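import Summits.QuantumFields.YangMills.Theorems.BalabanUVNodesN20QuantisedRatioNoRescueStubText
import Summits.QuantumFields.YangMills.Theorems.BalabanUVNodesN19NoDialRescuesLawSeparated

/-!
# BalabanUVNodes ∕ N20·N19′·N21 — K3⁷ v5's STUB 2 IS FALSE MODULO ONE LETTER (LS): what the registered stub texts PREDICT at the record is LAW MERGE of the two
# runs' across-class laws `S ↦ Σ_S weightB₁₃ ∕ Σ_T weightB₁₃`, `S ↦ Σ_S weightA₁₃ ∕ Σ_T weightA₁₃` ALONG [I] Thm 2's TUNED SEQUENCES at every live guarded admissible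
# Stage-13 tuple carrying (B) and the UV endpoint; hence a LAW-SEPARATED record (cofinally in the tuning window, at ONE such tuple) makes the stub-1 TEXT and the stub-2
# TEXT jointly unsatisfiable — the H-lemma `stub2_false_of_H` of CRIT-1's triage (ed. 2, item 4) in kernel form, BY NAME over `Thm/BalabanUVNodesK3V5Defs` (p606160)

Cell `pub-ymgap`, YM-PLAN Track A (HUMAN RULING D-0062; D-0149 ∕ D-0154, director-ym R399 (3a)); width seat `pub-ymgap-dag-n20-w5` (g2) on node N20 = NE7b; key item K3⁷
`SpineGivenEndpointR13SepCoPH` = stmt-QuantumFields-20544 (`--kind proof --supports 20544 --as helper`); COUNT-NEUTRAL.  Bus: CLAIM-1 ∕ INTENT-1 of g2 (pub-ymgap INBOX l.30093).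
Fourth file of the seat's lineage: `…N20QuantisedRatioNoRescue` (p606977) → `…AtRecord` (p608022) → `…StubText` (p608344; the (Q) ∧ (ACn) edition of §2 below) → THIS, which
consumes dag-n19-w4's `…N19NoDialRescuesLawSeparated` (p608854: `lawMerge_of_faces`, CRIT-1 ed. 2 Rec. (a)) exactly as its author handed it over (INBOX l.29942): «`no_dial_rescues` ∘
the `crOfRecord₁₃VAt_T ∕ _A ∕ _B` rfl's ∘ `ForSmallCouplings` cofinality; `hpos` from `KeyedExtraction` + `schemeZ_pos`».  [I] = [Balaban1987RG1] — LOCATION only (Thm 2 p. 259: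
the tuned bare sequences of `T4ContinuumYM4Torus.ForSmallCouplings`), nothing printed is used.

WHAT IT SAYS.  The four faces of `stub_expansion13H`'s conclusion at a witness `(jc, sh, cr)` — `KeyedRelWeight cr` (N20), `KeyedShellWeight cr` (N21), `KeyedExtraction cr`
(N27x), `KeyedCoreEdgeHolderD4 β cr rr` (N19′) — together with `PinnedAtLive jc sh cr` and the rates conjunct `KeyedRatesHolderD4 β rr` of `stub_rates13H` IMPLY, at every
tuple `(F, θ, hP)` passing the guard `ZhUnity ∧ SlotsNondegenerate₁₃`, `Admissible`, carrying (B) and the endpoint at its datum of record and lying on the live-selector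
line: `ForSmallCouplings (datumOfRecord₁₃CoPH F 2 θ hP) (g₀ ↦ ∀ os, ∀ s > 0, ∀ᶠ K, ∀ |t| ≤ 1, ∀ S ⊆ classSet₁₃ θ 0 g₀ K, |μ_B(S) − μ_A(S)| < s)` — the two across-class
laws of the record's keyed class weights MERGE, uniformly over class sets and admissible sources, along every tuned bare sequence of the window (§2 ★★ `lawMerge_of_keyedFaces`;
§3 ★★★ `lawMerge_of_stubTexts` for the two REGISTERED TEXTS verbatim).  Mechanism: the rates conjunct and the core ∕ extraction faces live under ONE prefix `(B) → END →
ForSmallCouplings`, so `ForSmallCouplings.and` puts them on the same tuned `g₀`; there the pin makes the carriers dag-n20-d's `crOfRecord₁₃VAt 0 (jc …) sh` whose `l₀ ∕ T ∕ A ∕ B`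
are `1 ∕ classSet₁₃ ∕ weightA₁₃ ∕ weightB₁₃` by `rfl` (NO dial reads them), the extraction face's E1 row with `schemeZ_pos_datumOfRecord₁₃CoPH` gives positive run-A totals, and
`lawMerge_of_faces` does the rest.  CONTRAPOSITIVES (the H-lemmas): if at ONE such tuple the laws are `s`-SEPARATED for some `s > 0` — dag-n19-w4's `hsep` shape VERBATIM at the
dial-free letters — NOT EVENTUALLY EXCLUDED in the tuning window (`¬ ForSmallCouplings D (g₀ ↦ ∀ os s, 0 < s → ¬ hsep)`: cofinally some tuned `g₀`, some `os` carry it), then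
no pinned witness carries the four faces (§2 `not_keyedFaces_of_lawSeparated`), the stub-1 TEXT refutes the stub-2 TEXT (§3 ★★ `stubTwoText_false_of_stubOneText_of_lawSeparated`),
i.e. the v5 skeleton cannot close AS CUT (§3 `not_stubTexts_of_lawSeparated`).  §4: the EVENTUAL form of the letter (`ForSmallCouplings D (g₀ ↦ ∃ os s, 0 < s ∧ hsep)`) implies
the cofinal one under the endpoint, by [I] Thm 2's non-vacuity `ForSmallCouplings.toE`.  §5: the (Q) ∧ (ACn) ROWS edition of §3, from p608344.

HONEST FRAMING.  NEGATIVE LEMMAS MODULO A HYPOTHESIS H and their positive contrapositive; H = «the record's two across-class laws are (LS)-separated [§5: (Q)-quantised with an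
anti-concentrated label] COFINALLY along [I] Thm 2's tuned bare sequences, at ONE live guarded admissible Stage-13 tuple carrying (B) and the UV endpoint» — UNDECIDED physics (crux
card `window-key-core` N1 ∕ (XG); `N20-W5-XG-LOCATED.md` on 20544), inhabited by nobody (K0⁷ `Record13SepCoPHInhabited` OPEN), NOT asserted here.  Hence: NOT a refutation of
`stub_expansion13H`; NOT a `Theorems/SpineGivenEndpointR13SepCoPH/Negative/` lemma (the conclusions deny STUB TEXTS, never `SpineGivenEndpointR13SepCoPH`, which another skeleton may
still close); proves NO estimate; nothing of Bałaban's asserted or instantiated; NE7 ∕ NE7b ∕ NE7c NOT PRINTED for d = 4, NOT proved; N19 ∕ N20 ∕ N21 NOT discharged; K3⁷ OPEN,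
skeleton v5 941dddb108cbaacf STANDS, not claimed; counts UNMOVED (typed 28∕28 · discharged 5∕27, A 5∕28); no count claim; no summit statement is proved by this seat; one finite 𝕋⁴
programme at fixed ε, Bałaban AS PRINTED — R4 closes the conditional rung `BalabanLadder.UV` only; the YM mass gap (Clay) is NOT proved by any of this; NOT ℝ⁴, NOT OS.  No `def`,
no `instance`, no `notation`, no `sorry`; [folklore] bookkeeping; no decl carries a cite tag.
-/

noncomputable section

open Finset Real
open _root_.Filter _root_.Topology

namespace Summit.QuantumFields.YangMills.BalabanUVNodes.N20StubTwoFalseOfLawSeparated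

open Literature.MathematicalPhysics.QuantumFieldTheory.Balaban1983to89
open Literature.MathematicalPhysics.QuantumFieldTheory.Balaban1983to89.T4WeightBudget (RelWeightBound)
open Literature.MathematicalPhysics.QuantumFieldTheory.Balaban1983to89.T4IndicatorShell (ShellWeightBound)
open Literature.MathematicalPhysics.QuantumFieldTheory.Balaban1983to89.T4Continuum
open Literature.MathematicalPhysics.QuantumFieldTheory.Balaban1983to89.Node00
open T4ContinuumYM4Torus (ForSmallCouplings)
open Summit.QuantumFields.BalabanUV.T4Continuum.Spine.NE7 (Core)
open YMDAG.UVSplit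
open Summit.QuantumFields.YangMills.Theorems.K3V5Defs
open Summit.QuantumFields.YangMills.Theorems.N20AtRecord13 (schemeZ_pos_datumOfRecord₁₃CoPH)
open Summit.QuantumFields.YangMills.BalabanUVNodes.N19NoDialRescuesLawSeparated (lawMerge_of_faces)
open Summit.QuantumFields.YangMills.BalabanUVNodes.N20QuantisedRatioNoRescueStubText (not_keyedFaces_of_pinnedAtLive_of_rows)

/-! ## §1 At dag-n20-d's reading of record `crOfRecord₁₃VAt K₀ jcut sh` (any `N`, any offset): law merge in the DIAL-FREE letters; merge vs. separation -/

section AtTheReading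

variable {F : T4Family} {N : ℕ} [NeZero N]

/-- **MERGE CONTRADICTS SEPARATION** (pure bookkeeping at the record's keyed class weights): if for all large `K` every admissible source and every class set have
`|μ_B(S) − μ_A(S)| < s`, then `(T, A, B) = (classSet₁₃, weightA₁₃, weightB₁₃)` is not `s`-separated cofinally in `K` (dag-n19-w4's `hsep` shape). [folklore] -/
theorem false_of_lawMerge_of_lawSeparated (K₀ : ℕ) (θ : Stage13HParams F N) (hP : θ.Provisos₁₃CoPH F N) (g₀ : ℕ → ℝ) (os : List (ULoop F)) {s : ℝ}
    (hmerge : ∀ᶠ K in atTop, ∀ t : ℝ, |t| ≤ 1 → ∀ S, S ⊆ classSet₁₃ θ K₀ g₀ K →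
      |(∑ x ∈ S, weightB₁₃ θ hP K₀ g₀ os K t x) / (∑ x ∈ classSet₁₃ θ K₀ g₀ K, weightB₁₃ θ hP K₀ g₀ os K t x) -
          (∑ x ∈ S, weightA₁₃ θ hP K₀ g₀ os K t x) / (∑ x ∈ classSet₁₃ θ K₀ g₀ K, weightA₁₃ θ hP K₀ g₀ os K t x)| < s)
    (hsep : ∀ K₁ : ℕ, ∃ K, K₁ ≤ K ∧ ∃ t : ℝ, |t| ≤ 1 ∧ ∃ S, S ⊆ classSet₁₃ θ K₀ g₀ K ∧
      s ≤ (∑ x ∈ S, weightB₁₃ θ hP K₀ g₀ os K t x) / (∑ x ∈ classSet₁₃ θ K₀ g₀ K, weightB₁₃ θ hP K₀ g₀ os K t x) -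
          (∑ x ∈ S, weightA₁₃ θ hP K₀ g₀ os K t x) / (∑ x ∈ classSet₁₃ θ K₀ g₀ K, weightA₁₃ θ hP K₀ g₀ os K t x)) : False := by
  obtain ⟨K₁, hK₁⟩ := hmerge.exists_forall_of_atTop
  obtain ⟨K, hK, t, ht, S, hS, hsKS⟩ := hsep K₁
  have h := hK₁ K hK t ht S hS
  linarith [le_abs_self ((∑ x ∈ S, weightB₁₃ θ hP K₀ g₀ os K t x) / (∑ x ∈ classSet₁₃ θ K₀ g₀ K, weightB₁₃ θ hP K₀ g₀ os K t x) -
    (∑ x ∈ S, weightA₁₃ θ hP K₀ g₀ os K t x) / (∑ x ∈ classSet₁₃ θ K₀ g₀ K, weightA₁₃ θ hP K₀ g₀ os K t x))]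

/-- ★ **LAW MERGE AT THE READING OF RECORD, DIAL-FREE LETTERS.**  The three K5 face-bodies of K3⁷ v5 stub 2 at `crOfRecord₁₃VAt K₀ jcut sh F θ hP g₀ os` — `RelWeightBound`
(N20), `ShellWeightBound` (N21), `NE7.Core` on the cores with a summable `δ` (N19′) — plus positive run-A totals on the window `|t| ≤ 1` give, for every `s > 0` and all large
`K`: `|Σ_S weightB₁₃ ∕ Σ_T weightB₁₃ − Σ_S weightA₁₃ ∕ Σ_T weightA₁₃| < s` for every admissible source and EVERY class set `S ⊆ classSet₁₃ θ K₀ g₀ K`.  This is dag-n19-w4's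
`lawMerge_of_faces` read through the `rfl` dictionary `crOfRecord₁₃VAt_l₀ ∕ _T ∕ _A ∕ _B` (= `1 ∕ classSet₁₃ ∕ weightA₁₃ ∕ weightB₁₃`): the cut value `jcut` (it moves only
`Bad`, `W`) and the shell split `sh` (only `shA`, `shB`, `Wsh`) have DISAPPEARED from the conclusion. [folklore] -/
theorem lawMerge_crOfRecord₁₃VAt_of_faces (K₀ : ℕ) (jcut : ℕ → ℕ) (sh : ShellSplit₁₃CoPH N K₀)
    (θ : Stage13HParams F N) (hP : θ.Provisos₁₃CoPH F N) (g₀ : ℕ → ℝ) (os : List (ULoop F))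
    (hW : RelWeightBound (crOfRecord₁₃VAt K₀ jcut sh F θ hP g₀ os).l₀ (crOfRecord₁₃VAt K₀ jcut sh F θ hP g₀ os).T (crOfRecord₁₃VAt K₀ jcut sh F θ hP g₀ os).A
      (crOfRecord₁₃VAt K₀ jcut sh F θ hP g₀ os).B (crOfRecord₁₃VAt K₀ jcut sh F θ hP g₀ os).Bad (crOfRecord₁₃VAt K₀ jcut sh F θ hP g₀ os).W)
    (hSh : ShellWeightBound (crOfRecord₁₃VAt K₀ jcut sh F θ hP g₀ os).l₀ (crOfRecord₁₃VAt K₀ jcut sh F θ hP g₀ os).T (crOfRecord₁₃VAt K₀ jcut sh F θ hP g₀ os).A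
      (crOfRecord₁₃VAt K₀ jcut sh F θ hP g₀ os).B (crOfRecord₁₃VAt K₀ jcut sh F θ hP g₀ os).shA (crOfRecord₁₃VAt K₀ jcut sh F θ hP g₀ os).shB
      (crOfRecord₁₃VAt K₀ jcut sh F θ hP g₀ os).Wsh)
    {δ : ℕ → ℝ}
    (hcore : letI := (crOfRecord₁₃VAt K₀ jcut sh F θ hP g₀ os).dec
      Core (crOfRecord₁₃VAt K₀ jcut sh F θ hP g₀ os).l₀ (crOfRecord₁₃VAt K₀ jcut sh F θ hP g₀ os).vol (crOfRecord₁₃VAt K₀ jcut sh F θ hP g₀ os).T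
        (crOfRecord₁₃VAt K₀ jcut sh F θ hP g₀ os).Bad
        (fun K t τ => (crOfRecord₁₃VAt K₀ jcut sh F θ hP g₀ os).A K t τ - (crOfRecord₁₃VAt K₀ jcut sh F θ hP g₀ os).shA K t τ)
        (fun K t τ => (crOfRecord₁₃VAt K₀ jcut sh F θ hP g₀ os).B K t τ - (crOfRecord₁₃VAt K₀ jcut sh F θ hP g₀ os).shB K t τ) δ)
    (hδ : Summable δ)
    (hpos : ∀ (K : ℕ) (t : ℝ), |t| ≤ 1 → 0 < ∑ x ∈ classSet₁₃ θ K₀ g₀ K, weightA₁₃ θ hP K₀ g₀ os K t x)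
    {s : ℝ} (hs : 0 < s) :
    ∀ᶠ K in atTop, ∀ t : ℝ, |t| ≤ 1 → ∀ S, S ⊆ classSet₁₃ θ K₀ g₀ K →
      |(∑ x ∈ S, weightB₁₃ θ hP K₀ g₀ os K t x) / (∑ x ∈ classSet₁₃ θ K₀ g₀ K, weightB₁₃ θ hP K₀ g₀ os K t x) -
          (∑ x ∈ S, weightA₁₃ θ hP K₀ g₀ os K t x) / (∑ x ∈ classSet₁₃ θ K₀ g₀ K, weightA₁₃ θ hP K₀ g₀ os K t x)| < s := by
  letI := (crOfRecord₁₃VAt K₀ jcut sh F θ hP g₀ os).dec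
  exact lawMerge_of_faces hW hSh hcore hδ hpos hs

/-- ★ **A LAW-SEPARATED RECORD CARRIES NO FACES, WHATEVER THE CUT VALUE AND THE SHELL SPLIT** (the (LS) twin of the companion's `not_faces_crOfRecord₁₃VAt_of_quantised_antiConc`,
p608022): if the two across-class laws of `(classSet₁₃, weightA₁₃, weightB₁₃)` are `s`-separated cofinally in `K` for some `s > 0` (dag-n19-w4's `hsep`, dial-free letters) and the
run-A totals are positive on the window, then at `crOfRecord₁₃VAt K₀ jcut sh F θ hP g₀ os` the three face-bodies `RelWeightBound ∧ ShellWeightBound ∧ ∃ δ, Core … δ ∧ Summable δ`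
do NOT hold together.  (LS) at the record is a DISPLAYED HYPOTHESIS, decided by nobody. [folklore] -/
theorem not_faces_crOfRecord₁₃VAt_of_lawSeparated (K₀ : ℕ) (jcut : ℕ → ℕ) (sh : ShellSplit₁₃CoPH N K₀)
    (θ : Stage13HParams F N) (hP : θ.Provisos₁₃CoPH F N) (g₀ : ℕ → ℝ) (os : List (ULoop F)) {s : ℝ} (hs : 0 < s)
    (hsep : ∀ K₁ : ℕ, ∃ K, K₁ ≤ K ∧ ∃ t : ℝ, |t| ≤ 1 ∧ ∃ S, S ⊆ classSet₁₃ θ K₀ g₀ K ∧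
      s ≤ (∑ x ∈ S, weightB₁₃ θ hP K₀ g₀ os K t x) / (∑ x ∈ classSet₁₃ θ K₀ g₀ K, weightB₁₃ θ hP K₀ g₀ os K t x) -
          (∑ x ∈ S, weightA₁₃ θ hP K₀ g₀ os K t x) / (∑ x ∈ classSet₁₃ θ K₀ g₀ K, weightA₁₃ θ hP K₀ g₀ os K t x))
    (hpos : ∀ (K : ℕ) (t : ℝ), |t| ≤ 1 → 0 < ∑ x ∈ classSet₁₃ θ K₀ g₀ K, weightA₁₃ θ hP K₀ g₀ os K t x) :
    letI := (crOfRecord₁₃VAt K₀ jcut sh F θ hP g₀ os).dec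
    ¬ (RelWeightBound (crOfRecord₁₃VAt K₀ jcut sh F θ hP g₀ os).l₀ (crOfRecord₁₃VAt K₀ jcut sh F θ hP g₀ os).T (crOfRecord₁₃VAt K₀ jcut sh F θ hP g₀ os).A
          (crOfRecord₁₃VAt K₀ jcut sh F θ hP g₀ os).B (crOfRecord₁₃VAt K₀ jcut sh F θ hP g₀ os).Bad (crOfRecord₁₃VAt K₀ jcut sh F θ hP g₀ os).W ∧
       ShellWeightBound (crOfRecord₁₃VAt K₀ jcut sh F θ hP g₀ os).l₀ (crOfRecord₁₃VAt K₀ jcut sh F θ hP g₀ os).T (crOfRecord₁₃VAt K₀ jcut sh F θ hP g₀ os).A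
          (crOfRecord₁₃VAt K₀ jcut sh F θ hP g₀ os).B (crOfRecord₁₃VAt K₀ jcut sh F θ hP g₀ os).shA (crOfRecord₁₃VAt K₀ jcut sh F θ hP g₀ os).shB
          (crOfRecord₁₃VAt K₀ jcut sh F θ hP g₀ os).Wsh ∧
       ∃ δ : ℕ → ℝ, Core (crOfRecord₁₃VAt K₀ jcut sh F θ hP g₀ os).l₀ (crOfRecord₁₃VAt K₀ jcut sh F θ hP g₀ os).vol (crOfRecord₁₃VAt K₀ jcut sh F θ hP g₀ os).T
          (crOfRecord₁₃VAt K₀ jcut sh F θ hP g₀ os).Bad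
          (fun K t τ => (crOfRecord₁₃VAt K₀ jcut sh F θ hP g₀ os).A K t τ - (crOfRecord₁₃VAt K₀ jcut sh F θ hP g₀ os).shA K t τ)
          (fun K t τ => (crOfRecord₁₃VAt K₀ jcut sh F θ hP g₀ os).B K t τ - (crOfRecord₁₃VAt K₀ jcut sh F θ hP g₀ os).shB K t τ) δ ∧ Summable δ) := by
  letI := (crOfRecord₁₃VAt K₀ jcut sh F θ hP g₀ os).dec
  rintro ⟨hW, hSh, δ, hcore, hδ⟩
  exact false_of_lawMerge_of_lawSeparated K₀ θ hP g₀ os (lawMerge_crOfRecord₁₃VAt_of_faces K₀ jcut sh θ hP g₀ os hW hSh hcore hδ hpos hs) hsep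

end AtTheReading

/-! ## §2 At a spine reading PINNED AT LIVE (`N = 2`, offset `0`): the four v5 faces + the v5 rates conjunct ⇒ law merge along tuning; (LS) ⇒ no faces -/

section AtThePin

variable {F : T4Family}

/-- **ONE TUNED SEQUENCE, ONE LOOP STRING.**  At a tuple on the live-selector line, the N20 ∕ N21 face-bodies of a reading `cr` pinned by `PinnedAtLive jc sh cr`, its N19′ core
body (SOME summable `δ`) and its extraction row E1 («run A's class sums ARE the dressed partition functions `schemeZ` of the datum of record», whence positive totals by
`schemeZ_pos_datumOfRecord₁₃CoPH`) at `(g₀, os)` give law merge of `(classSet₁₃ θ 0 g₀, weightA₁₃, weightB₁₃)` at `(g₀, os)`.  The hypotheses are the v5 face texts' bodies at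
`(F, θ, hP, g₀, os)` VERBATIM. [folklore] -/
theorem lawMerge_at_of_pinnedFaces (jc : CutReading) (sh : ShellSplit₁₃CoPH 2 0) (cr : SpineReading) (hpin : PinnedAtLive jc sh cr)
    (θ : Stage13HParams F 2) (hP : θ.Provisos₁₃CoPH F 2) (g₀ : ℕ → ℝ) (os : List (ULoop F)) (hlive : LiveSel F θ)
    (hW : RelWeightBound (cr F θ hP g₀ os).l₀ (cr F θ hP g₀ os).T (cr F θ hP g₀ os).A (cr F θ hP g₀ os).B (cr F θ hP g₀ os).Bad (cr F θ hP g₀ os).W)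
    (hSh : ShellWeightBound (cr F θ hP g₀ os).l₀ (cr F θ hP g₀ os).T (cr F θ hP g₀ os).A (cr F θ hP g₀ os).B (cr F θ hP g₀ os).shA (cr F θ hP g₀ os).shB
      (cr F θ hP g₀ os).Wsh)
    (hC : letI := (cr F θ hP g₀ os).dec
      ∃ δ : ℕ → ℝ, Core (cr F θ hP g₀ os).l₀ (cr F θ hP g₀ os).vol (cr F θ hP g₀ os).T (cr F θ hP g₀ os).Bad
        (fun K t τ => (cr F θ hP g₀ os).A K t τ - (cr F θ hP g₀ os).shA K t τ) (fun K t τ => (cr F θ hP g₀ os).B K t τ - (cr F θ hP g₀ os).shB K t τ) δ ∧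
        Summable δ)
    (hE1 : ∀ (K : ℕ) (t : ℝ), |t| ≤ (cr F θ hP g₀ os).l₀ →
      T4GenFunBounds.schemeZ ((datumOfRecord₁₃CoPH F 2 θ hP).scheme g₀) os ((cr F θ hP g₀ os).K₀ + K) t = ∑ τ ∈ (cr F θ hP g₀ os).T K, (cr F θ hP g₀ os).A K t τ)
    {s : ℝ} (hs : 0 < s) :
    ∀ᶠ K in atTop, ∀ t : ℝ, |t| ≤ 1 → ∀ S, S ⊆ classSet₁₃ θ 0 g₀ K →
      |(∑ x ∈ S, weightB₁₃ θ hP 0 g₀ os K t x) / (∑ x ∈ classSet₁₃ θ 0 g₀ K, weightB₁₃ θ hP 0 g₀ os K t x) -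
          (∑ x ∈ S, weightA₁₃ θ hP 0 g₀ os K t x) / (∑ x ∈ classSet₁₃ θ 0 g₀ K, weightA₁₃ θ hP 0 g₀ os K t x)| < s := by
  have e : cr F θ hP g₀ os = crOfRecord₁₃VAt 0 (jc F θ hP g₀ os) sh F θ hP g₀ os := hpin F θ hP g₀ os hlive
  rw [e] at hW hSh hC hE1
  obtain ⟨δ, hcore, hδ⟩ := hC
  refine lawMerge_crOfRecord₁₃VAt_of_faces 0 (jc F θ hP g₀ os) sh θ hP g₀ os hW hSh hcore hδ (fun K t ht => ?_) hs
  have h := schemeZ_pos_datumOfRecord₁₃CoPH θ hP g₀ os ((crOfRecord₁₃VAt 0 (jc F θ hP g₀ os) sh F θ hP g₀ os).K₀ + K) t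
  rw [hE1 K t ht] at h
  exact h

/-- ★★ **THE FOUR v5 FACES AND THE v5 RATES CONJUNCT PREDICT LAW MERGE ALONG TUNING.**  For ANY exponent `β`, rate reading `rr`, and witness `(jc, sh, cr)` pinned at live: if
`KeyedRatesHolderD4 β rr` (stub 1's rates conjunct) and the four faces `KeyedRelWeight cr ∧ KeyedShellWeight cr ∧ KeyedExtraction cr ∧ KeyedCoreEdgeHolderD4 β cr rr` (stub 2's
conclusion) hold, then at every guarded admissible tuple carrying (B) and the endpoint on the live-selector line, along EVERY tuned bare sequence of [I] Thm 2's window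
(`ForSmallCouplings`): for every loop string, every `s > 0`, all large `K`, every `|t| ≤ 1` and every `S ⊆ classSet₁₃ θ 0 g₀ K`, `|μ_B(S) − μ_A(S)| < s`.  Proof: `ForSmallCouplings.and`
puts the rates, the core face and the extraction face on the same `g₀`; then `lawMerge_at_of_pinnedFaces`. [folklore] -/
theorem lawMerge_of_keyedFaces (β : ℝ) (rr : RateReadingFn) (jc : CutReading) (sh : ShellSplit₁₃CoPH 2 0) (cr : SpineReading)
    (hrates : KeyedRatesHolderD4 β rr) (hpin : PinnedAtLive jc sh cr)
    (h20 : KeyedRelWeight cr) (h21 : KeyedShellWeight cr) (hx : KeyedExtraction cr) (h19 : KeyedCoreEdgeHolderD4 β cr rr)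
    (θ : Stage13HParams F 2) (hP : θ.Provisos₁₃CoPH F 2) (hG : θ.ZhUnity F 2 ∧ θ.SlotsNondegenerate₁₃ F 2) (hθ : θ.Admissible F 2)
    (hB : B16.EndStatementBPrinted (datumOfRecord₁₃CoPH F 2 θ hP).C) (hE : DagBinding.EndpointExistence (datumOfRecord₁₃CoPH F 2 θ hP).C.toB12)
    (hlive : LiveSel F θ) :
    ForSmallCouplings (datumOfRecord₁₃CoPH F 2 θ hP) fun g₀ => ∀ (os : List (ULoop F)) (s : ℝ), 0 < s →
      ∀ᶠ K in atTop, ∀ t : ℝ, |t| ≤ 1 → ∀ S, S ⊆ classSet₁₃ θ 0 g₀ K →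
        |(∑ x ∈ S, weightB₁₃ θ hP 0 g₀ os K t x) / (∑ x ∈ classSet₁₃ θ 0 g₀ K, weightB₁₃ θ hP 0 g₀ os K t x) -
            (∑ x ∈ S, weightA₁₃ θ hP 0 g₀ os K t x) / (∑ x ∈ classSet₁₃ θ 0 g₀ K, weightA₁₃ θ hP 0 g₀ os K t x)| < s := by
  refine (((hrates F θ hP hG hθ hB hE).and (h19 F θ hP hG hθ hB hE)).and (hx F θ hP hG hθ hB hE)).mono fun g₀ hg os s hs => ?_
  obtain ⟨⟨hR, hcore⟩, hX⟩ := hg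
  exact lawMerge_at_of_pinnedFaces jc sh cr hpin θ hP g₀ os hlive (h20 F θ hP hG hθ g₀ os) (h21 F θ hP hG hθ g₀ os) (hcore os (hR os)) (hX os).2.2.1 hs

/-- ★★ **THE H-LEMMA AT THE FOUR FACES: (LS) COFINAL IN THE WINDOW ⇒ NO PINNED WITNESS.**  If at ONE guarded admissible tuple with (B) and the endpoint on the live-selector line the
record's laws are `s`-separated for some `s > 0` (dial-free `hsep`), NOT eventually excluded along tuning — `¬ ForSmallCouplings D (g₀ ↦ ∀ os s, 0 < s → ¬ hsep)` — then for every
`β`, every `rr` with `KeyedRatesHolderD4 β rr` and every `(jc, sh, cr)` with `PinnedAtLive jc sh cr`: `¬ (KeyedRelWeight cr ∧ KeyedShellWeight cr ∧ KeyedExtraction cr ∧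
KeyedCoreEdgeHolderD4 β cr rr)`.  H is DISPLAYED, not asserted. [folklore] -/
theorem not_keyedFaces_of_lawSeparated (β : ℝ) (rr : RateReadingFn) (jc : CutReading) (sh : ShellSplit₁₃CoPH 2 0) (cr : SpineReading)
    (hrates : KeyedRatesHolderD4 β rr) (hpin : PinnedAtLive jc sh cr)
    (θ : Stage13HParams F 2) (hP : θ.Provisos₁₃CoPH F 2) (hG : θ.ZhUnity F 2 ∧ θ.SlotsNondegenerate₁₃ F 2) (hθ : θ.Admissible F 2)
    (hB : B16.EndStatementBPrinted (datumOfRecord₁₃CoPH F 2 θ hP).C) (hE : DagBinding.EndpointExistence (datumOfRecord₁₃CoPH F 2 θ hP).C.toB12)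
    (hlive : LiveSel F θ)
    (hLS : ¬ ForSmallCouplings (datumOfRecord₁₃CoPH F 2 θ hP) fun g₀ => ∀ (os : List (ULoop F)) (s : ℝ), 0 < s →
      ¬ ∀ K₁ : ℕ, ∃ K, K₁ ≤ K ∧ ∃ t : ℝ, |t| ≤ 1 ∧ ∃ S, S ⊆ classSet₁₃ θ 0 g₀ K ∧
        s ≤ (∑ x ∈ S, weightB₁₃ θ hP 0 g₀ os K t x) / (∑ x ∈ classSet₁₃ θ 0 g₀ K, weightB₁₃ θ hP 0 g₀ os K t x) -
            (∑ x ∈ S, weightA₁₃ θ hP 0 g₀ os K t x) / (∑ x ∈ classSet₁₃ θ 0 g₀ K, weightA₁₃ θ hP 0 g₀ os K t x)) :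
    ¬ (KeyedRelWeight cr ∧ KeyedShellWeight cr ∧ KeyedExtraction cr ∧ KeyedCoreEdgeHolderD4 β cr rr) := by
  rintro ⟨h20, h21, hx, h19⟩
  exact hLS ((lawMerge_of_keyedFaces β rr jc sh cr hrates hpin h20 h21 hx h19 θ hP hG hθ hB hE hlive).mono fun g₀ hg os s hs hsep =>
    false_of_lawMerge_of_lawSeparated 0 θ hP g₀ os (hg os s hs) hsep)

/-- **RATES-BUNDLED TWIN** (the hypothesis shape of the companion's `not_keyedFaces_of_pinnedAtLive_of_rows`, p608344, with (LS) for the rows; no separate rates conjunct): if at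
one such tuple `¬ ForSmallCouplings D (g₀ ↦ ∀ os, PHolderD4 β D (rr …) → ∀ s > 0, ¬ hsep)` — cofinally some tuned `g₀`, `os` carry the rates TOGETHER WITH an `s`-separation —
then no pinned witness carries the four faces for this `β`, `rr`. [folklore] -/
theorem not_keyedFaces_of_ratesWithLawSeparated (β : ℝ) (rr : RateReadingFn) (jc : CutReading) (sh : ShellSplit₁₃CoPH 2 0) (cr : SpineReading)
    (hpin : PinnedAtLive jc sh cr)
    (θ : Stage13HParams F 2) (hP : θ.Provisos₁₃CoPH F 2) (hG : θ.ZhUnity F 2 ∧ θ.SlotsNondegenerate₁₃ F 2) (hθ : θ.Admissible F 2)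
    (hB : B16.EndStatementBPrinted (datumOfRecord₁₃CoPH F 2 θ hP).C) (hE : DagBinding.EndpointExistence (datumOfRecord₁₃CoPH F 2 θ hP).C.toB12)
    (hlive : LiveSel F θ)
    (hLS : ¬ ForSmallCouplings (datumOfRecord₁₃CoPH F 2 θ hP) fun g₀ => ∀ os : List (ULoop F),
      PHolderD4 β (datumOfRecord₁₃CoPH F 2 θ hP) (rr F θ hP g₀ os) → ∀ s : ℝ, 0 < s →
        ¬ ∀ K₁ : ℕ, ∃ K, K₁ ≤ K ∧ ∃ t : ℝ, |t| ≤ 1 ∧ ∃ S, S ⊆ classSet₁₃ θ 0 g₀ K ∧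
          s ≤ (∑ x ∈ S, weightB₁₃ θ hP 0 g₀ os K t x) / (∑ x ∈ classSet₁₃ θ 0 g₀ K, weightB₁₃ θ hP 0 g₀ os K t x) -
              (∑ x ∈ S, weightA₁₃ θ hP 0 g₀ os K t x) / (∑ x ∈ classSet₁₃ θ 0 g₀ K, weightA₁₃ θ hP 0 g₀ os K t x)) :
    ¬ (KeyedRelWeight cr ∧ KeyedShellWeight cr ∧ KeyedExtraction cr ∧ KeyedCoreEdgeHolderD4 β cr rr) := by
  rintro ⟨h20, h21, hx, h19⟩
  refine hLS (((h19 F θ hP hG hθ hB hE).and (hx F θ hP hG hθ hB hE)).mono fun g₀ hg os hP4 s hs hsep => ?_)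
  obtain ⟨hcore, hX⟩ := hg
  exact false_of_lawMerge_of_lawSeparated 0 θ hP g₀ os
    (lawMerge_at_of_pinnedFaces jc sh cr hpin θ hP g₀ os hlive (h20 F θ hP hG hθ g₀ os) (h21 F θ hP hG hθ g₀ os) (hcore os hP4) (hX os).2.2.1 hs) hsep

end AtThePin

/-! ## §3 At the two REGISTERED STUB TEXTS of K3⁷ v5 (941dddb108cbaacf), BY NAME over `K3V5Defs`: the prediction, and the H-lemma -/

section AtTheTexts

variable {F : T4Family}

/-- ★★★ **WHAT THE v5 SKELETON PREDICTS AT THE RECORD: LAW MERGE ALONG TUNING.**  If the TEXT of `stub_rates13H` (left) and the TEXT of `stub_expansion13H` (right) both hold —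
the texts VERBATIM over the mirrored names, as in `K3V5Defs.spineGivenEndpointR13SepCoPH_of_stubTexts` — then at every Stage-13 tuple passing `ZhUnity ∧ SlotsNondegenerate₁₃`,
`Admissible`, carrying (B) and the UV endpoint at its datum of record, on the live-selector line: along every tuned bare sequence of [I] Thm 2's window the two across-class laws of
`(classSet₁₃ θ 0 g₀, weightA₁₃, weightB₁₃)` merge — `ForSmallCouplings D (g₀ ↦ ∀ os, ∀ s > 0, ∀ᶠ K, ∀ |t| ≤ 1, ∀ S ⊆ classSet₁₃ θ 0 g₀ K, |μ_B(S) − μ_A(S)| < s)`.  A TESTABLE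
consequence of the skeleton AS CUT, at dial-free letters (no `jc`, no `sh`, no `Bad ∕ W ∕ shA ∕ shB ∕ Wsh ∕ δ`).  NOT a proof of either stub. [folklore] -/
theorem lawMerge_of_stubTexts
    (h₁ : ∃ β : ℝ, 2 / 3 < β ∧ β < 1 ∧ ∃ (𝔯 : RateReading₁₃CoPH 2) (ksel : RunSel) (ℓ : LetterReading) (ℓ₃ : T4Family → Node00.NE3Letters₁₁) (g B : T4Family → ℝ),
      GuardedReadingN16 𝔯 ksel ℓ ℓ₃ g B ∧ KeyedRatesHolderD4 β (rrOfRecord 𝔯 ksel))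
    (h₂ : ∀ β : ℝ, 2 / 3 < β → β < 1 → ∀ (𝔯 : RateReading₁₃CoPH 2) (ksel : RunSel) (ℓ : LetterReading) (ℓ₃ : T4Family → Node00.NE3Letters₁₁) (g B : T4Family → ℝ),
      GuardedReadingN16 𝔯 ksel ℓ ℓ₃ g B → KeyedRatesHolderD4 β (rrOfRecord 𝔯 ksel) →
      ∃ (jc : CutReading) (sh : ShellSplit₁₃CoPH 2 0) (cr : SpineReading), PinnedAtLive jc sh cr ∧
        KeyedRelWeight cr ∧ KeyedShellWeight cr ∧ KeyedExtraction cr ∧ KeyedCoreEdgeHolderD4 β cr (rrOfRecord 𝔯 ksel))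
    (θ : Stage13HParams F 2) (hP : θ.Provisos₁₃CoPH F 2) (hG : θ.ZhUnity F 2 ∧ θ.SlotsNondegenerate₁₃ F 2) (hθ : θ.Admissible F 2)
    (hB : B16.EndStatementBPrinted (datumOfRecord₁₃CoPH F 2 θ hP).C) (hE : DagBinding.EndpointExistence (datumOfRecord₁₃CoPH F 2 θ hP).C.toB12)
    (hlive : LiveSel F θ) :
    ForSmallCouplings (datumOfRecord₁₃CoPH F 2 θ hP) fun g₀ => ∀ (os : List (ULoop F)) (s : ℝ), 0 < s →
      ∀ᶠ K in atTop, ∀ t : ℝ, |t| ≤ 1 → ∀ S, S ⊆ classSet₁₃ θ 0 g₀ K →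
        |(∑ x ∈ S, weightB₁₃ θ hP 0 g₀ os K t x) / (∑ x ∈ classSet₁₃ θ 0 g₀ K, weightB₁₃ θ hP 0 g₀ os K t x) -
            (∑ x ∈ S, weightA₁₃ θ hP 0 g₀ os K t x) / (∑ x ∈ classSet₁₃ θ 0 g₀ K, weightA₁₃ θ hP 0 g₀ os K t x)| < s := by
  obtain ⟨β, hβ, hβ', 𝔯, ksel, ℓ, ℓ₃, g, B, hg, hr⟩ := h₁
  obtain ⟨jc, sh, cr, hpin, h20, h21, hx, h19⟩ := h₂ β hβ hβ' 𝔯 ksel ℓ ℓ₃ g B hg hr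
  exact lawMerge_of_keyedFaces β (rrOfRecord 𝔯 ksel) jc sh cr hr hpin h20 h21 hx h19 θ hP hG hθ hB hE hlive

/-- ★★ **THE H-LEMMA `stub2_false_of_H` AT THE REGISTERED TEXTS** (CRIT-1 triage ed. 2, item 4, kernel form).  H (LS, cofinal): SOME Stage-13 tuple `(F, θ, hP)` passes the guard, is
admissible, carries (B) and the endpoint at its datum of record, lies on the live-selector line, AND there the record's two across-class laws are `s`-separated for some `s > 0`
(dial-free `hsep`) NOT eventually excluded along [I] Thm 2's tuned sequences.  THEN the TEXT of `stub_rates13H` REFUTES the TEXT of `stub_expansion13H`.  H is a DISPLAYED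
HYPOTHESIS — (LS) at the record is UNDECIDED physics and the tuple is inhabited by nobody (K0⁷ OPEN); this is NOT a refutation of the stub and NOT `¬ SpineGivenEndpointR13SepCoPH`. [folklore] -/
theorem stubTwoText_false_of_stubOneText_of_lawSeparated
    (hH : ∃ (F : T4Family) (θ : Stage13HParams F 2) (hP : θ.Provisos₁₃CoPH F 2),
      (θ.ZhUnity F 2 ∧ θ.SlotsNondegenerate₁₃ F 2) ∧ θ.Admissible F 2 ∧
      B16.EndStatementBPrinted (datumOfRecord₁₃CoPH F 2 θ hP).C ∧ DagBinding.EndpointExistence (datumOfRecord₁₃CoPH F 2 θ hP).C.toB12 ∧ LiveSel F θ ∧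
      ¬ ForSmallCouplings (datumOfRecord₁₃CoPH F 2 θ hP) fun g₀ => ∀ (os : List (ULoop F)) (s : ℝ), 0 < s →
        ¬ ∀ K₁ : ℕ, ∃ K, K₁ ≤ K ∧ ∃ t : ℝ, |t| ≤ 1 ∧ ∃ S, S ⊆ classSet₁₃ θ 0 g₀ K ∧
          s ≤ (∑ x ∈ S, weightB₁₃ θ hP 0 g₀ os K t x) / (∑ x ∈ classSet₁₃ θ 0 g₀ K, weightB₁₃ θ hP 0 g₀ os K t x) -
              (∑ x ∈ S, weightA₁₃ θ hP 0 g₀ os K t x) / (∑ x ∈ classSet₁₃ θ 0 g₀ K, weightA₁₃ θ hP 0 g₀ os K t x))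
    (h₁ : ∃ β : ℝ, 2 / 3 < β ∧ β < 1 ∧ ∃ (𝔯 : RateReading₁₃CoPH 2) (ksel : RunSel) (ℓ : LetterReading) (ℓ₃ : T4Family → Node00.NE3Letters₁₁) (g B : T4Family → ℝ),
      GuardedReadingN16 𝔯 ksel ℓ ℓ₃ g B ∧ KeyedRatesHolderD4 β (rrOfRecord 𝔯 ksel)) :
    ¬ ∀ β : ℝ, 2 / 3 < β → β < 1 → ∀ (𝔯 : RateReading₁₃CoPH 2) (ksel : RunSel) (ℓ : LetterReading) (ℓ₃ : T4Family → Node00.NE3Letters₁₁) (g B : T4Family → ℝ),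
      GuardedReadingN16 𝔯 ksel ℓ ℓ₃ g B → KeyedRatesHolderD4 β (rrOfRecord 𝔯 ksel) →
      ∃ (jc : CutReading) (sh : ShellSplit₁₃CoPH 2 0) (cr : SpineReading), PinnedAtLive jc sh cr ∧
        KeyedRelWeight cr ∧ KeyedShellWeight cr ∧ KeyedExtraction cr ∧ KeyedCoreEdgeHolderD4 β cr (rrOfRecord 𝔯 ksel) := by
  intro h₂
  obtain ⟨F, θ, hP, hG, hθ, hB, hE, hlive, hLS⟩ := hH
  exact hLS ((lawMerge_of_stubTexts h₁ h₂ θ hP hG hθ hB hE hlive).mono fun g₀ hg os s hs hsep =>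
    false_of_lawMerge_of_lawSeparated 0 θ hP g₀ os (hg os s hs) hsep)

/-- ★ **UNDER (LS) THE v5 SKELETON CANNOT CLOSE AS CUT**: with H as in `stubTwoText_false_of_stubOneText_of_lawSeparated`, the two registered stub texts are JOINTLY UNSATISFIABLE.
Says nothing about `SpineGivenEndpointR13SepCoPH` itself (another skeleton may close it) — hence a flat helper, not a `Negative/` lemma. [folklore] -/
theorem not_stubTexts_of_lawSeparated
    (hH : ∃ (F : T4Family) (θ : Stage13HParams F 2) (hP : θ.Provisos₁₃CoPH F 2),
      (θ.ZhUnity F 2 ∧ θ.SlotsNondegenerate₁₃ F 2) ∧ θ.Admissible F 2 ∧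
      B16.EndStatementBPrinted (datumOfRecord₁₃CoPH F 2 θ hP).C ∧ DagBinding.EndpointExistence (datumOfRecord₁₃CoPH F 2 θ hP).C.toB12 ∧ LiveSel F θ ∧
      ¬ ForSmallCouplings (datumOfRecord₁₃CoPH F 2 θ hP) fun g₀ => ∀ (os : List (ULoop F)) (s : ℝ), 0 < s →
        ¬ ∀ K₁ : ℕ, ∃ K, K₁ ≤ K ∧ ∃ t : ℝ, |t| ≤ 1 ∧ ∃ S, S ⊆ classSet₁₃ θ 0 g₀ K ∧
          s ≤ (∑ x ∈ S, weightB₁₃ θ hP 0 g₀ os K t x) / (∑ x ∈ classSet₁₃ θ 0 g₀ K, weightB₁₃ θ hP 0 g₀ os K t x) -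
              (∑ x ∈ S, weightA₁₃ θ hP 0 g₀ os K t x) / (∑ x ∈ classSet₁₃ θ 0 g₀ K, weightA₁₃ θ hP 0 g₀ os K t x)) :
    ¬ ((∃ β : ℝ, 2 / 3 < β ∧ β < 1 ∧ ∃ (𝔯 : RateReading₁₃CoPH 2) (ksel : RunSel) (ℓ : LetterReading) (ℓ₃ : T4Family → Node00.NE3Letters₁₁) (g B : T4Family → ℝ),
        GuardedReadingN16 𝔯 ksel ℓ ℓ₃ g B ∧ KeyedRatesHolderD4 β (rrOfRecord 𝔯 ksel)) ∧
      ∀ β : ℝ, 2 / 3 < β → β < 1 → ∀ (𝔯 : RateReading₁₃CoPH 2) (ksel : RunSel) (ℓ : LetterReading) (ℓ₃ : T4Family → Node00.NE3Letters₁₁) (g B : T4Family → ℝ),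
        GuardedReadingN16 𝔯 ksel ℓ ℓ₃ g B → KeyedRatesHolderD4 β (rrOfRecord 𝔯 ksel) →
        ∃ (jc : CutReading) (sh : ShellSplit₁₃CoPH 2 0) (cr : SpineReading), PinnedAtLive jc sh cr ∧
          KeyedRelWeight cr ∧ KeyedShellWeight cr ∧ KeyedExtraction cr ∧ KeyedCoreEdgeHolderD4 β cr (rrOfRecord 𝔯 ksel)) :=
  fun h => stubTwoText_false_of_stubOneText_of_lawSeparated hH h.1 h.2

end AtTheTexts

/-! ## §4 The EVENTUAL form of the letter implies the cofinal one under the endpoint ([I] Thm 2's non-vacuity `ForSmallCouplings.toE`) -/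

section Eventual

variable {F : T4Family}

/-- **UNDER THE ENDPOINT, `ForSmallCouplings c` EXCLUDES `ForSmallCouplings ¬c`**: tuned bare sequences exist for all small `γ`, `g` (`T4Continuum.FiniteEpsData.exists_tuned` via
`ForSmallCouplings.toE`), so a conclusion and its negation cannot both hold eventually in the window.  Converts an EVENTUAL letter into the COFINAL hypothesis of §2–§3. [folklore] -/
theorem not_forSmallCouplings_not_of_forSmallCouplings (θ : Stage13HParams F 2) (hP : θ.Provisos₁₃CoPH F 2)
    (hE : DagBinding.EndpointExistence (datumOfRecord₁₃CoPH F 2 θ hP).C.toB12) {c : (ℕ → ℝ) → Prop}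
    (h : ForSmallCouplings (datumOfRecord₁₃CoPH F 2 θ hP) c) :
    ¬ ForSmallCouplings (datumOfRecord₁₃CoPH F 2 θ hP) fun g₀ => ¬ c g₀ := by
  intro hn
  obtain ⟨γ₀, hγ₀, H⟩ := (h.and hn).toE hE
  obtain ⟨g₁, hg₁, Hg⟩ := H γ₀ hγ₀ le_rfl
  obtain ⟨g₀, -, hc, hnc⟩ := Hg g₁ hg₁ le_rfl
  exact hnc hc

/-- ★ **THE H-LEMMA, EVENTUAL EDITION.**  If at one guarded admissible tuple with (B) and the endpoint on the live-selector line the `s`-separation of the record's laws holds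
EVENTUALLY in the window — `ForSmallCouplings D (g₀ ↦ ∃ os s, 0 < s ∧ hsep)`: for all small `γ`, `g` and every tuned `g₀`, some loop string is law-separated — then the TEXT of
`stub_rates13H` refutes the TEXT of `stub_expansion13H`.  (A stronger letter than §3's cofinal H; displayed, not asserted.) [folklore] -/
theorem stubTwoText_false_of_stubOneText_of_lawSeparated_eventually
    (hH : ∃ (F : T4Family) (θ : Stage13HParams F 2) (hP : θ.Provisos₁₃CoPH F 2),
      (θ.ZhUnity F 2 ∧ θ.SlotsNondegenerate₁₃ F 2) ∧ θ.Admissible F 2 ∧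
      B16.EndStatementBPrinted (datumOfRecord₁₃CoPH F 2 θ hP).C ∧ DagBinding.EndpointExistence (datumOfRecord₁₃CoPH F 2 θ hP).C.toB12 ∧ LiveSel F θ ∧
      ForSmallCouplings (datumOfRecord₁₃CoPH F 2 θ hP) fun g₀ => ∃ (os : List (ULoop F)) (s : ℝ), 0 < s ∧
        ∀ K₁ : ℕ, ∃ K, K₁ ≤ K ∧ ∃ t : ℝ, |t| ≤ 1 ∧ ∃ S, S ⊆ classSet₁₃ θ 0 g₀ K ∧
          s ≤ (∑ x ∈ S, weightB₁₃ θ hP 0 g₀ os K t x) / (∑ x ∈ classSet₁₃ θ 0 g₀ K, weightB₁₃ θ hP 0 g₀ os K t x) -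
              (∑ x ∈ S, weightA₁₃ θ hP 0 g₀ os K t x) / (∑ x ∈ classSet₁₃ θ 0 g₀ K, weightA₁₃ θ hP 0 g₀ os K t x))
    (h₁ : ∃ β : ℝ, 2 / 3 < β ∧ β < 1 ∧ ∃ (𝔯 : RateReading₁₃CoPH 2) (ksel : RunSel) (ℓ : LetterReading) (ℓ₃ : T4Family → Node00.NE3Letters₁₁) (g B : T4Family → ℝ),
      GuardedReadingN16 𝔯 ksel ℓ ℓ₃ g B ∧ KeyedRatesHolderD4 β (rrOfRecord 𝔯 ksel)) :
    ¬ ∀ β : ℝ, 2 / 3 < β → β < 1 → ∀ (𝔯 : RateReading₁₃CoPH 2) (ksel : RunSel) (ℓ : LetterReading) (ℓ₃ : T4Family → Node00.NE3Letters₁₁) (g B : T4Family → ℝ),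
      GuardedReadingN16 𝔯 ksel ℓ ℓ₃ g B → KeyedRatesHolderD4 β (rrOfRecord 𝔯 ksel) →
      ∃ (jc : CutReading) (sh : ShellSplit₁₃CoPH 2 0) (cr : SpineReading), PinnedAtLive jc sh cr ∧
        KeyedRelWeight cr ∧ KeyedShellWeight cr ∧ KeyedExtraction cr ∧ KeyedCoreEdgeHolderD4 β cr (rrOfRecord 𝔯 ksel) := by
  obtain ⟨F, θ, hP, hG, hθ, hB, hE, hlive, hev⟩ := hH
  refine stubTwoText_false_of_stubOneText_of_lawSeparated ⟨F, θ, hP, hG, hθ, hB, hE, hlive, fun hall => ?_⟩ h₁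
  exact not_forSmallCouplings_not_of_forSmallCouplings θ hP hE hev (hall.mono fun g₀ hg ⟨os, s, hs, hsep⟩ => hg os s hs hsep)

end Eventual

/-! ## §5 The (Q) ∧ (ACn) ROWS edition of §3 (from the companion `…N20QuantisedRatioNoRescueStubText`, p608344) -/

section Rows

variable {F : T4Family}

/-- ★ **THE H-LEMMA, ROWS EDITION.**  H (rows, cofinal): SOME guarded admissible tuple with (B) and the endpoint on the live-selector line at which the rows (Q) ∧ (ACn) of
`…N20QuantisedRatioNoRescue` — a `D`-quantised two-run log-ratio `log(weightB₁₃ ∕ weightA₁₃)` along an integer key label up to `ε < D∕4`, anti-concentrated under `weightA₁₃`,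
with positive run-A total, frequently in `K` at some `|t| ≤ 1` (p608344's text VERBATIM) — are NOT eventually excluded along tuning.  THEN the TEXT of `stub_rates13H` refutes the
TEXT of `stub_expansion13H`: stub 1's rates conjunct and `ForSmallCouplings.and` turn H into p608344's rates-bundled hypothesis.  (Q) with `D ≠ 0` is the card's (XG) — UNDECIDED
at the record, NOT asserted. [folklore] -/
theorem stubTwoText_false_of_stubOneText_of_rows
    (hH : ∃ (F : T4Family) (θ : Stage13HParams F 2) (hP : θ.Provisos₁₃CoPH F 2),
      (θ.ZhUnity F 2 ∧ θ.SlotsNondegenerate₁₃ F 2) ∧ θ.Admissible F 2 ∧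
      B16.EndStatementBPrinted (datumOfRecord₁₃CoPH F 2 θ hP).C ∧ DagBinding.EndpointExistence (datumOfRecord₁₃CoPH F 2 θ hP).C.toB12 ∧ LiveSel F θ ∧
      ¬ ForSmallCouplings (datumOfRecord₁₃CoPH F 2 θ hP) fun g₀ => ∀ os : List (ULoop F),
        ¬ ∃ (D ε m : ℝ) (v : ℕ → ℝ → (Σ K, SiteSeqKey F (0 + K)) → ℤ) (c₀ : ℕ → ℝ → ℝ),
          0 < D ∧ ε < D / 4 ∧ 0 ≤ m ∧ m * (1 + exp (3 * D / 4)) ≤ 1 / 2 ∧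
          ∃ᶠ K in atTop, ∃ t : ℝ, |t| ≤ 1 ∧ 0 < ∑ x ∈ classSet₁₃ θ 0 g₀ K, weightA₁₃ θ hP 0 g₀ os K t x ∧
            (∀ x ∈ classSet₁₃ θ 0 g₀ K,
              exp (c₀ K t + D * (v K t x : ℝ) - ε) * weightA₁₃ θ hP 0 g₀ os K t x ≤ weightB₁₃ θ hP 0 g₀ os K t x ∧
                weightB₁₃ θ hP 0 g₀ os K t x ≤ exp (c₀ K t + D * (v K t x : ℝ) + ε) * weightA₁₃ θ hP 0 g₀ os K t x) ∧
            (∀ n : ℤ, ∑ x ∈ (classSet₁₃ θ 0 g₀ K).filter (fun x => v K t x = n), weightA₁₃ θ hP 0 g₀ os K t x ≤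
              m * ∑ x ∈ classSet₁₃ θ 0 g₀ K, weightA₁₃ θ hP 0 g₀ os K t x))
    (h₁ : ∃ β : ℝ, 2 / 3 < β ∧ β < 1 ∧ ∃ (𝔯 : RateReading₁₃CoPH 2) (ksel : RunSel) (ℓ : LetterReading) (ℓ₃ : T4Family → Node00.NE3Letters₁₁) (g B : T4Family → ℝ),
      GuardedReadingN16 𝔯 ksel ℓ ℓ₃ g B ∧ KeyedRatesHolderD4 β (rrOfRecord 𝔯 ksel)) :
    ¬ ∀ β : ℝ, 2 / 3 < β → β < 1 → ∀ (𝔯 : RateReading₁₃CoPH 2) (ksel : RunSel) (ℓ : LetterReading) (ℓ₃ : T4Family → Node00.NE3Letters₁₁) (g B : T4Family → ℝ),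
      GuardedReadingN16 𝔯 ksel ℓ ℓ₃ g B → KeyedRatesHolderD4 β (rrOfRecord 𝔯 ksel) →
      ∃ (jc : CutReading) (sh : ShellSplit₁₃CoPH 2 0) (cr : SpineReading), PinnedAtLive jc sh cr ∧
        KeyedRelWeight cr ∧ KeyedShellWeight cr ∧ KeyedExtraction cr ∧ KeyedCoreEdgeHolderD4 β cr (rrOfRecord 𝔯 ksel) := by
  intro h₂
  obtain ⟨F, θ, hP, hG, hθ, hB, hE, hlive, hrows⟩ := hH
  obtain ⟨β, hβ, hβ', 𝔯, ksel, ℓ, ℓ₃, g, B, hg, hr⟩ := h₁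
  obtain ⟨jc, sh, cr, hpin, h20, h21, -, h19⟩ := h₂ β hβ hβ' 𝔯 ksel ℓ ℓ₃ g B hg hr
  refine not_keyedFaces_of_pinnedAtLive_of_rows β (rrOfRecord 𝔯 ksel) jc sh cr hpin θ hP hG hθ hB hE hlive (fun hcontra => ?_) ⟨h20, h21, h19⟩
  exact hrows (((hr F θ hP hG hθ hB hE).and hcontra).mono fun g₀ hg os => hg.2 os (hg.1 os))

end Rows

end Summit.QuantumFields.YangMills.BalabanUVNodes.N20StubTwoFalseOfLawSeparated

end
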